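import Mathlib
import Summits.CriticalPhenomena.SAWScalingLimit.Theses.SAWDefectDecoherence
import Summits.CriticalPhenomena.SAWScalingLimit.Theorems.SAWDefectDecoherenceDefectDecoherenceSsTipRegrouping
import Summits.CriticalPhenomena.SAWScalingLimit.Theorems.SAWDefectDecoherenceDefectDecoherenceSsSectorRowD
import Summits.CriticalPhenomena.SAWScalingLimit.Theorems.SAWDefectDecoherenceDefectDecoherenceSsDefectSlaving
import Summits.CriticalPhenomena.SAWScalingLimit.Theorems.SAWDefectDecoherenceDefectDecoherenceSsStarMassHarnack
import Literature.Probability.RandomPlanarGeometry.HexDomainSingleton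
import HarnessLib

/-!
# Reduction of the crux `SAWDefectDecoherence.DefectDecoherence` along the line `sector-slaving`
(stmt-CriticalPhenomena-8549; lead prover c2; vocabulary `…/Theorems/SAWDefectDecoherenceSectorSlavingDefs.lean`)

The line slaves the clean defect sector `A_D = A_{13/8}` of the `x_c`-weighted arrival law to its
sources by the exact `D`-row of the sector system (`stub_sectorRowD`, landed) and a discrete maximum
principle on the depth (`stub_defectSlaving`, landed); the exact tip regrouping (`stub_tipRegrouping`,
landed) carries the crux onto these objects.  This file assembles the landed pieces into the line's
CONDITIONAL CLOSURE of the crux BY NAME: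

* `defectDecoherence_of_tipReturnLoopBound_of_sources`: the crux follows from
  (A) a uniform bound `N ≤ 8` on the `x_c`-mass of self-avoiding RETURN LOOPS at an exterior tip of a
  simply connected domain (the line's one positive-mass input; closed into the neighbour star-mass
  Harnack inequality by the landed `har_starMassHarnack_of_loopBound`), and the three mass-relative
  decay estimates at a rate `θ > 3/4` (4) `DecayBound unstableSource`, (5) `DecayBound signalSource`,
  (6) `DecayBound dressedDefect` — open estimates on critical planar SAW;
* `ss_tipReturnLoopBound_of_sourceLoopBound`: input (A) is a corollary (with `N = max c 0 ≤ 1`) of the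
  statement of the EXISTING item `SAWDevelopingMap.SourceLoopBound` (stmt-CriticalPhenomena-8300, written
  out verbatim as a hypothesis: loops around a boundary vertex `v` of a simply connected `Λ` inside
  `Λ.erase v` have `x_c`-mass `≤ c < sin(π/8)`), via `Λ := insert t Λ'` — inserting the tip keeps the
  complement connected because the tip has exactly one exterior neighbour (`ss_simplyConnected_insert_tip`);
* `defectDecoherence_of_sourceLoopBound_of_sources`: the two composed.

Also recorded: the unconditional a-priori bound `‖A_ξ(v)‖ ≤ M(v)/2` (`ss_aprioriArrivalBound`, from the
landed mass identity) and the composition of the parts (`ss_decayBound_defect_of_inputs`).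

Sources: H. Duminil-Copin, S. Smirnov, Ann. of Math. 175 (2012) (arXiv:1007.0575); the line card
`Cruxes/DefectDecoherence/Lines/sector-slaving.md`; skeleton `Cruxes/DefectDecoherence/Lines/sector_slaving.lean`.
-/

noncomputable section

open scoped BigOperators ComplexConjugate Classical
open Literature.Probability.LatticeModels Literature.Probability.RandomPlanarGeometry.SAW
open Literature.Probability.Percolation (PathIn)
open Summit.CriticalPhenomena.SAWScalingLimit.Theorems.DefectDecoherence.TipMartingale

namespace Summit.CriticalPhenomena.SAWScalingLimit.Theorems.DefectDecoherence.SectorSlaving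

/-! ### The a-priori bound and the composition of the parts -/

/-- **A-priori bound** `‖A_ξ(v)‖ ≤ M(v)/2` at every `1`-deep vertex, for every character `ξ`: termwise
`‖A_ξ‖ ≤ A_0` and the landed mass identity `M = x_c⁻¹ Ā_0 + 2 A_0` with `Ā_0 ≥ 0`. [folklore] -/
theorem ss_aprioriArrivalBound : AprioriArrivalBound (1 / 2) := by
  intro Λ u w huw hu hw v hdeep ξ
  obtain ⟨-, hM⟩ := stub_tipRegrouping Λ u w huw hu hw v hdeep
  set A0 : ℝ := ∑ s ∈ star Λ v, ∑ γ : HexMidEdgeSAW Λ s(u, w) s(s, v),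
      (if γ.verts.getLast? = some s ∧ v ∉ γ.verts then xc ^ (γ.length + 1) else 0 : ℝ) with hA0
  set V0 : ℝ := ∑ s ∈ star Λ v, ∑ γ : HexMidEdgeSAW Λ s(u, w) s(s, v),
      (if γ.verts.getLast? = some s then xc ^ (γ.length + 1) else 0 : ℝ) with hV0
  have hxc : 0 ≤ xc := hexCriticalFugacity_pos_lt_one.1.le
  have hA : arrivalSum Λ s(u, w) (rootAngle u w) 0 v = (A0 : ℂ) := by
    rw [hA0, arrivalSum]
    push_cast
    refine Finset.sum_congr rfl fun s _ => Finset.sum_congr rfl fun γ _ => ?_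
    split_ifs <;> simp
  have hV : viaSum Λ s(u, w) (rootAngle u w) 0 v = (V0 : ℂ) := by
    rw [hV0, viaSum]
    push_cast
    refine Finset.sum_congr rfl fun s _ => Finset.sum_congr rfl fun γ _ => ?_
    split_ifs <;> simp
  have hV0nn : 0 ≤ V0 :=
    Finset.sum_nonneg fun s _ => Finset.sum_nonneg fun γ _ => by
      split_ifs
      · exact pow_nonneg hxc _
      · exact le_rfl
  have hmass : mass Λ u w v = xc⁻¹ * V0 + 2 * A0 := by
    rw [hA, hV] at hM
    exact_mod_cast hM
  have hnorm : ‖arrivalSum Λ s(u, w) (rootAngle u w) ξ v‖ ≤ A0 := norm_arrivalSum_le _ _ _ _ _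
  have hxi : 0 ≤ xc⁻¹ * V0 := mul_nonneg (inv_nonneg.2 hxc) hV0nn
  calc ‖arrivalSum Λ s(u, w) (rootAngle u w) ξ v‖ ≤ A0 := hnorm
    _ ≤ 1 / 2 * mass Λ u w v := by rw [hmass]; linarith

/-- **Composition of the parts** (triangle inequality on the tip regrouping
`T = κ·(x_c⁻¹ Ā_D + 2 sin(π/24) A_D)`, `‖κ‖ ≤ 1`): the neighbour star-mass Harnack input and the three
decay estimates give `DecayBound defect C θ` with `θ = min θ_clean θ_dressed > 3/4`, the clean decay
coming from the landed slaving induction `stub_defectSlaving`. [folklore] -/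
theorem ss_decayBound_defect_of_inputs
    (hHar : ∃ c : ℝ, c * slavingCoupling < 3 ∧ NeighbourMassBound c)
    (hU : ∃ C θ : ℝ, 3 / 4 < θ ∧ DecayBound unstableSource C θ)
    (hS : ∃ C θ : ℝ, 3 / 4 < θ ∧ DecayBound signalSource C θ)
    (hDress : ∃ C θ : ℝ, 3 / 4 < θ ∧ DecayBound dressedDefect C θ) :
    ∃ C θ : ℝ, 3 / 4 < θ ∧ DecayBound defect C θ := by
  obtain ⟨C₁, θ₁, hθ₁, hClean⟩ :=
    stub_defectSlaving stub_sectorRowD ss_aprioriArrivalBound hHar hU hS hDress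
  obtain ⟨C₂, θ₂, hθ₂, hDirty⟩ := hDress
  have hxc : 0 < xc := hexCriticalFugacity_pos_lt_one.1
  have hxi : 0 ≤ xc⁻¹ := le_of_lt (inv_pos.mpr hxc)
  refine ⟨(xc⁻¹ + 2) * |C₁| + xc⁻¹ * |C₂|, min θ₁ θ₂, lt_min hθ₁ hθ₂, ?_⟩
  intro Λ hΛ u w huw hu hw v R hR hdeep
  have h1 := hClean Λ hΛ u w huw hu hw v R hR hdeep
  have h2 := hDirty Λ hΛ u w huw hu hw v R hR hdeep
  have hdeep1 : Deep Λ v 1 := fun y hy => hdeep y (hy.trans hR)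
  obtain ⟨hT, -⟩ := stub_tipRegrouping Λ u w huw hu hw v hdeep1
  set A := arrivalSum Λ s(u, w) (rootAngle u w) (13 / 8) v with hAdef
  set Ab := viaSum Λ s(u, w) (rootAngle u w) (13 / 8) v with hAbdef
  set M := mass Λ u w v with hMdef
  have hA' : cleanDefect Λ u w v = A := rfl
  have hAb' : dressedDefect Λ u w v = Ab - A := rfl
  rw [hA'] at h1
  rw [hAb'] at h2
  have hM0 : 0 ≤ M := mass_nonneg Λ u w v
  have hR0 : 0 ≤ R := le_trans zero_le_one hR
  have hmono₁ : R ^ (-θ₁) ≤ R ^ (-min θ₁ θ₂) :=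
    Real.rpow_le_rpow_of_exponent_le hR (neg_le_neg (min_le_left θ₁ θ₂))
  have hmono₂ : R ^ (-θ₂) ≤ R ^ (-min θ₁ θ₂) :=
    Real.rpow_le_rpow_of_exponent_le hR (neg_le_neg (min_le_right θ₁ θ₂))
  have e1 : ‖A‖ ≤ |C₁| * (R ^ (-min θ₁ θ₂) * M) := by
    calc ‖A‖ ≤ C₁ * R ^ (-θ₁) * M := h1
      _ ≤ |C₁| * R ^ (-θ₁) * M :=
          mul_le_mul_of_nonneg_right
            (mul_le_mul_of_nonneg_right (le_abs_self _) (Real.rpow_nonneg hR0 _)) hM0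
      _ ≤ |C₁| * R ^ (-min θ₁ θ₂) * M :=
          mul_le_mul_of_nonneg_right (mul_le_mul_of_nonneg_left hmono₁ (abs_nonneg _)) hM0
      _ = |C₁| * (R ^ (-min θ₁ θ₂) * M) := by ring
  have e2 : ‖Ab - A‖ ≤ |C₂| * (R ^ (-min θ₁ θ₂) * M) := by
    calc ‖Ab - A‖ ≤ C₂ * R ^ (-θ₂) * M := h2
      _ ≤ |C₂| * R ^ (-θ₂) * M :=
          mul_le_mul_of_nonneg_right
            (mul_le_mul_of_nonneg_right (le_abs_self _) (Real.rpow_nonneg hR0 _)) hM0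
      _ ≤ |C₂| * R ^ (-min θ₁ θ₂) * M :=
          mul_le_mul_of_nonneg_right (mul_le_mul_of_nonneg_left hmono₂ (abs_nonneg _)) hM0
      _ = |C₂| * (R ^ (-min θ₁ θ₂) * M) := by ring
  have hκ : ‖tipPhase u w‖ ≤ 1 := by
    unfold tipPhase
    rw [norm_mul, Complex.norm_exp_ofReal_mul_I, mul_one, Complex.norm_real, Real.norm_eq_abs,
      abs_neg, abs_of_nonneg (show (0 : ℝ) ≤ Real.sqrt 3 / 6 by positivity)]
    have h3 : Real.sqrt 3 ≤ 6 := by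
      nlinarith [Real.sq_sqrt (show (0 : ℝ) ≤ 3 by norm_num), Real.sqrt_nonneg 3]
    linarith
  have hsin : |2 * Real.sin (Real.pi / 24)| ≤ 2 := by
    rw [abs_le]
    constructor
    · nlinarith [Real.neg_one_le_sin (Real.pi / 24)]
    · nlinarith [Real.sin_le_one (Real.pi / 24)]
  have hX :
      ‖((xc⁻¹ : ℝ) : ℂ) * Ab + ((2 * Real.sin (Real.pi / 24) : ℝ) : ℂ) * A‖ ≤
        xc⁻¹ * ‖Ab‖ + 2 * ‖A‖ := by
    refine (norm_add_le _ _).trans ?_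
    rw [norm_mul, norm_mul, Complex.norm_real, Complex.norm_real, Real.norm_eq_abs,
      Real.norm_eq_abs, abs_of_nonneg hxi]
    have : |2 * Real.sin (Real.pi / 24)| * ‖A‖ ≤ 2 * ‖A‖ :=
      mul_le_mul_of_nonneg_right hsin (norm_nonneg _)
    linarith
  have hT' : ‖defect Λ u w v‖ ≤ xc⁻¹ * ‖Ab‖ + 2 * ‖A‖ := by
    rw [hT, norm_mul]
    have hk := mul_le_mul_of_nonneg_right hκ
      (norm_nonneg (((xc⁻¹ : ℝ) : ℂ) * Ab + ((2 * Real.sin (Real.pi / 24) : ℝ) : ℂ) * A))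
    linarith
  have hAb'' : ‖Ab‖ ≤ ‖A‖ + ‖Ab - A‖ := by
    calc ‖Ab‖ = ‖A + (Ab - A)‖ := by congr 1; ring
      _ ≤ ‖A‖ + ‖Ab - A‖ := norm_add_le _ _
  have e3 : xc⁻¹ * ‖Ab‖ ≤ xc⁻¹ * (‖A‖ + ‖Ab - A‖) := mul_le_mul_of_nonneg_left hAb'' hxi
  have e4 := mul_le_mul_of_nonneg_left e1 hxi
  have e5 := mul_le_mul_of_nonneg_left e2 hxi
  calc ‖defect Λ u w v‖ ≤ xc⁻¹ * ‖Ab‖ + 2 * ‖A‖ := hT'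
    _ ≤ xc⁻¹ * (‖A‖ + ‖Ab - A‖) + 2 * ‖A‖ := by linarith
    _ ≤ xc⁻¹ * (|C₁| * (R ^ (-min θ₁ θ₂) * M) + |C₂| * (R ^ (-min θ₁ θ₂) * M)) +
          2 * (|C₁| * (R ^ (-min θ₁ θ₂) * M)) := by
        linarith
    _ = ((xc⁻¹ + 2) * |C₁| + xc⁻¹ * |C₂|) * R ^ (-min θ₁ θ₂) * M := by ring

/-! ### The conditional closure of the crux from the tip return-loop bound and the three decay inputs -/

/-- **The line's conditional reduction.**  `DefectDecoherence` follows from (A) a uniform bound `N ≤ 8`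
on the `x_c`-mass of the self-avoiding return loops at an exterior tip of a simply connected hexagonal
domain and the three mass-relative decay estimates (θ > 3/4) for the `U`-source, the `S`-source and the
loop-dressed defect; everything else is landed (`stub_tipRegrouping`, `stub_sectorRowD`,
`stub_defectSlaving`, `har_starMassHarnack_of_loopBound`). [folklore] -/
theorem defectDecoherence_of_tipReturnLoopBound_of_sources :
    (∃ N : ℝ, 0 ≤ N ∧ N ≤ 8 ∧
      ∀ (Λ' : Finset HexVertex), hexDomainSimplyConnected Λ' → ∀ (t q s : HexVertex), t ∉ Λ' → q ∈ Λ' →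
        s ∈ Λ' → hexGraph.Adj t q → hexGraph.Adj t s → q ≠ s →
          (∑ τ : HexMidEdgeSAW Λ' s(t, q) s(s, t), xc ^ τ.length) ≤ N) →
    (∃ C θ : ℝ, 3 / 4 < θ ∧ DecayBound unstableSource C θ) →
    (∃ C θ : ℝ, 3 / 4 < θ ∧ DecayBound signalSource C θ) →
    (∃ C θ : ℝ, 3 / 4 < θ ∧ DecayBound dressedDefect C θ) →
      Summit.CriticalPhenomena.SAWScalingLimit.Theses.SAWDefectDecoherence.DefectDecoherence := by
  rintro ⟨N, hN0, hN8, hN⟩ hU hS hDress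
  obtain ⟨C, θ, hθ, hD⟩ :=
    ss_decayBound_defect_of_inputs (har_starMassHarnack_of_loopBound N hN0 hN8 hN) hU hS hDress
  exact ⟨C, θ, hθ, fun Λ hΛ u w huw hu hw v R hR hdeep => hD Λ hΛ u w huw hu hw v R hR hdeep⟩

/-! ### Inserting an exterior tip keeps the complement connected -/

section Tip

variable {Λ' : Finset HexVertex} {t q s : HexVertex}

/-- Two exterior neighbours of an exterior vertex `t` with two interior neighbours `q ≠ s` coincide
(`t` has exactly three neighbours). [folklore] -/
theorem ss_ext_nbr_unique (hq : q ∈ Λ') (hs : s ∈ Λ') (htq : hexGraph.Adj t q)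
    (hts : hexGraph.Adj t s) (hqs : q ≠ s) {a b : HexVertex} (ha : hexGraph.Adj t a)
    (hb : hexGraph.Adj t b) (haΛ : a ∉ Λ') (hbΛ : b ∉ Λ') : a = b := by
  have haq : a ≠ q := fun h => haΛ (h ▸ hq)
  have has : a ≠ s := fun h => haΛ (h ▸ hs)
  have hbq : b ≠ q := fun h => hbΛ (h ▸ hq)
  have hbs : b ≠ s := fun h => hbΛ (h ▸ hs)
  rcases (tip_adj_iff htq s).1 hts with h | h | h
  · exact absurd h.symm hqs
  · rcases (tip_adj_iff htq a).1 ha with h₁ | h₁ | h₁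
    · exact absurd h₁ haq
    · exact absurd (h₁.trans h.symm) has
    · rcases (tip_adj_iff htq b).1 hb with h₂ | h₂ | h₂
      · exact absurd h₂ hbq
      · exact absurd (h₂.trans h.symm) hbs
      · exact h₁.trans h₂.symm
  · rcases (tip_adj_iff htq a).1 ha with h₁ | h₁ | h₁
    · exact absurd h₁ haq
    · rcases (tip_adj_iff htq b).1 hb with h₂ | h₂ | h₂
      · exact absurd h₂ hbq
      · exact h₁.trans h₂.symm
      · exact absurd (h₂.trans h.symm) hbs
    · exact absurd (h₁.trans h.symm) has

/-- **Excising a leaf from a path in the complement.** If `t ∉ Λ'` has the interior neighbours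
`q ≠ s`, a path inside `Λ'ᶜ` from `x ≠ t` to `y ≠ t` can be rerouted inside `Λ'ᶜ ∖ {t}`: every
visit of `t` is a back-and-forth through its unique exterior neighbour. [folklore] -/
theorem ss_pathIn_excise (hq : q ∈ Λ') (hs : s ∈ Λ') (htq : hexGraph.Adj t q)
    (hts : hexGraph.Adj t s) (hqs : q ≠ s) {x y : HexVertex} (hx : x ≠ t)
    (h : PathIn hexGraph ((↑Λ' : Set HexVertex)ᶜ) x y) (hy : y ≠ t) :
    PathIn hexGraph ((↑(insert t Λ') : Set HexVertex)ᶜ) x y := by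
  obtain ⟨hxS, hR⟩ := h
  set S' : Set HexVertex := ((↑(insert t Λ') : Set HexVertex)ᶜ) with hS'
  have memS' : ∀ {z : HexVertex}, z ∉ Λ' → z ≠ t → z ∈ S' := fun hz hzt => by
    simp only [hS', Set.mem_compl_iff, Finset.coe_insert, Set.mem_insert_iff, Finset.mem_coe,
      not_or]
    exact ⟨hzt, hz⟩
  have hxΛ : x ∉ Λ' := hxS
  -- invariant along the chain
  suffices H : (y ≠ t → PathIn hexGraph S' x y) ∧
      (y = t → ∃ b, b ∉ Λ' ∧ hexGraph.Adj b t ∧ PathIn hexGraph S' x b) from H.1 hy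
  clear hy
  induction hR with
  | refl => exact ⟨fun _ => PathIn.refl (memS' hxΛ hx), fun h => absurd h hx⟩
  | @tail b c _ hbc ih =>
    obtain ⟨hadj, hcS⟩ := hbc
    have hcΛ : c ∉ Λ' := hcS
    have hbΛ : b ∉ Λ' := (PathIn.right_mem (G := hexGraph) (show PathIn hexGraph _ x b from ⟨hxS, ‹_›⟩))
    refine ⟨fun hct => ?_, fun hct => ?_⟩
    · by_cases hbt : b = t
      · subst hbt
        obtain ⟨b', hb'Λ, hb't, hP⟩ := ih.2 rfl
        have : c = b' := ss_ext_nbr_unique hq hs htq hts hqs hadj hb't.symm hcΛ hb'Λ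
        rw [this]; exact hP
      · exact (ih.1 hbt).tail hadj (memS' hcΛ hct)
    · subst hct
      have hbt : b ≠ c := hadj.ne
      exact ⟨b, hbΛ, hadj, ih.1 hbt⟩

/-- **Inserting an exterior tip keeps the domain simply connected**: if `Λ'` has a connected complement
and `t ∉ Λ'` has two interior neighbours `q ≠ s`, then `insert t Λ'` has a connected complement
(`t` is a leaf of the complement). [folklore] -/
theorem ss_simplyConnected_insert_tip (hΛ : hexDomainSimplyConnected Λ') (ht : t ∉ Λ')
    (hq : q ∈ Λ') (hs : s ∈ Λ') (htq : hexGraph.Adj t q) (hts : hexGraph.Adj t s) (hqs : q ≠ s) :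
    hexDomainSimplyConnected (insert t Λ') := by
  unfold hexDomainSimplyConnected at hΛ ⊢
  refine preconnected_induce_of_forall_pathIn fun x hx y hy => ?_
  have hx' : x ∉ Λ' ∧ x ≠ t := by
    simpa [Set.mem_compl_iff, Finset.coe_insert, Set.mem_insert_iff, not_or, and_comm] using hx
  have hy' : y ∉ Λ' ∧ y ≠ t := by
    simpa [Set.mem_compl_iff, Finset.coe_insert, Set.mem_insert_iff, not_or, and_comm] using hy
  have _ := ht
  exact ss_pathIn_excise hq hs htq hts hqs hx'.2 (pathIn_of_preconnected hΛ hx'.1 hy'.1) hy'.2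

/-- An exterior vertex `t ∉ Λ'` of a simply connected `Λ'` has an exterior neighbour (the first step
of a path in the infinite connected complement from `t` to another exterior vertex); it differs from
any interior vertices `q, s`. [folklore] -/
theorem ss_exists_ext_nbr (hΛ : hexDomainSimplyConnected Λ') (ht : t ∉ Λ') (hq : q ∈ Λ')
    (hs : s ∈ Λ') :
    ∃ r : HexVertex, hexGraph.Adj t r ∧ r ∉ Λ' ∧ r ≠ q ∧ r ≠ s := by
  -- a vertex of the complement other than `t`
  have hinf : (((↑(insert t Λ') : Set HexVertex))ᶜ).Infinite :=
    (Finset.finite_toSet _).infinite_compl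
  obtain ⟨z, hz⟩ := hinf.nonempty
  have hz' : z ∉ Λ' ∧ z ≠ t := by
    simpa [Set.mem_compl_iff, Finset.coe_insert, Set.mem_insert_iff, not_or, and_comm] using hz
  -- a path from `t` to `z` in the complement; its first step leaves `t` to an exterior neighbour
  have hP : PathIn hexGraph ((↑Λ' : Set HexVertex)ᶜ) t z := pathIn_of_preconnected hΛ ht hz'.1
  obtain ⟨a, b, ha, -, hbS, hab, -⟩ :=
    hP.exit (R := ({t} : Set HexVertex)) (Set.mem_singleton t) (by simpa using hz'.2)
  have hat : a = t := ha
  subst hat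
  refine ⟨b, hab, hbS, fun h => hbS (h ▸ hq), fun h => hbS (h ▸ hs)⟩

end Tip

/-! ### The tip return-loop bound from `SourceLoopBound` (stmt-CriticalPhenomena-8300) -/

/-- **Input (A) from `SAWDevelopingMap.SourceLoopBound`** (stmt-CriticalPhenomena-8300, written out
verbatim as the hypothesis): loops around a boundary vertex `v` of a simply connected `Λ` inside
`Λ.erase v` have critical mass `≤ c < sin(π/8)`; applied to `Λ := insert t Λ'`, `v := t`, `u :=` the
exterior neighbour of the tip, this is the tip return-loop bound with `N = max c 0 ≤ 1 ≤ 8`. [folklore] -/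
theorem ss_tipReturnLoopBound_of_sourceLoopBound
    (hSLB : ∃ c : ℝ, c < Real.sin (Real.pi / 8) ∧ ∀ (Λ : Finset HexVertex), hexDomainSimplyConnected Λ →
      ∀ u v w₁ w₂ : HexVertex, u ∉ Λ → v ∈ Λ → hexGraph.Adj v u → hexGraph.Adj v w₁ → hexGraph.Adj v w₂ →
        u ≠ w₁ → u ≠ w₂ → w₁ ≠ w₂ →
          (∑ γ : HexMidEdgeSAW (Λ.erase v) s(v, w₁) s(v, w₂), hexCriticalFugacity ^ γ.length) ≤ c) :
    ∃ N : ℝ, 0 ≤ N ∧ N ≤ 8 ∧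
      ∀ (Λ' : Finset HexVertex), hexDomainSimplyConnected Λ' → ∀ (t q s : HexVertex), t ∉ Λ' → q ∈ Λ' →
        s ∈ Λ' → hexGraph.Adj t q → hexGraph.Adj t s → q ≠ s →
          (∑ τ : HexMidEdgeSAW Λ' s(t, q) s(s, t), xc ^ τ.length) ≤ N := by
  obtain ⟨c, hc, h⟩ := hSLB
  refine ⟨max c 0, le_max_right _ _, ?_, ?_⟩
  · have : Real.sin (Real.pi / 8) ≤ 1 := Real.sin_le_one _
    exact max_le (by linarith) (by norm_num)
  intro Λ' hΛ t q s ht hq hs htq hts hqs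
  obtain ⟨r, htr, hr, hrq, hrs⟩ := ss_exists_ext_nbr hΛ ht hq hs
  have key := h (insert t Λ') (ss_simplyConnected_insert_tip hΛ ht hq hs htq hts hqs) r t q s
    (by simp [hr, htr.ne.symm]) (Finset.mem_insert_self t Λ') htr htq hts hrq hrs hqs
  rw [Finset.erase_insert ht, Sym2.eq_swap (a := t) (b := s)] at key
  exact key.trans (le_max_left _ _)

/-- **The crux from `SourceLoopBound` and the three decay inputs**: composition of
`ss_tipReturnLoopBound_of_sourceLoopBound` and `defectDecoherence_of_tipReturnLoopBound_of_sources`.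
[folklore] -/
theorem defectDecoherence_of_sourceLoopBound_of_sources
    (hSLB : ∃ c : ℝ, c < Real.sin (Real.pi / 8) ∧ ∀ (Λ : Finset HexVertex), hexDomainSimplyConnected Λ →
      ∀ u v w₁ w₂ : HexVertex, u ∉ Λ → v ∈ Λ → hexGraph.Adj v u → hexGraph.Adj v w₁ → hexGraph.Adj v w₂ →
        u ≠ w₁ → u ≠ w₂ → w₁ ≠ w₂ →
          (∑ γ : HexMidEdgeSAW (Λ.erase v) s(v, w₁) s(v, w₂), hexCriticalFugacity ^ γ.length) ≤ c)
    (hU : ∃ C θ : ℝ, 3 / 4 < θ ∧ DecayBound unstableSource C θ)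
    (hS : ∃ C θ : ℝ, 3 / 4 < θ ∧ DecayBound signalSource C θ)
    (hDress : ∃ C θ : ℝ, 3 / 4 < θ ∧ DecayBound dressedDefect C θ) :
    Summit.CriticalPhenomena.SAWScalingLimit.Theses.SAWDefectDecoherence.DefectDecoherence :=
  defectDecoherence_of_tipReturnLoopBound_of_sources (ss_tipReturnLoopBound_of_sourceLoopBound hSLB)
    hU hS hDress

end Summit.CriticalPhenomena.SAWScalingLimit.Theorems.DefectDecoherence.SectorSlaving

end
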